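import Literature.AlgebraicGeometry.HodgeTheory.MotivatedClassesDeformation
import Literature.AlgebraicGeometry.Motives.ProjectiveSpaceCells
import Literature.AlgebraicGeometry.Motives.SubschemeCycles
import HarnessLib

/-!
# The constant family `pr₂ : X ×ₖ C ⟶ C` and its fibres

For `k`-schemes `X`, `C` and a rational point `t ∈ C(k)`, the fibre of the second projection
`pr₂ : X ×ₖ C ⟶ C` over `t` (the tree's `fiberOver (snd X C) t = (X ×ₖ C) ×_C Spec k`) is
canonically `X`: both `X ×ₖ Spec k` and `(X ×ₖ C)_t` are the base change of `pr₂` along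
`t : Spec k ⟶ C` (`isPullback_snd_whiskerLeft`, `familyPullback.isPullback`), and `X ≅ X ×ₖ Spec k`.
Hartshorne, *Algebraic Geometry*, II.3 (fibres of a morphism; base extension), III.9–10 (families).

* `sliceFiberIso X t : X ≅ fiberOver (snd X C) t` — the slice isomorphism; composed with the fibre
  inclusion it is the slice `sliceAt X t = (𝟙, t) : X ⟶ X ×ₖ C` (`sliceFiberIso_hom_fiberι`), so
  `≫ pr₁` gives `𝟙 X` and `≫ pr₂` the constant map to `t`;
* `IsSmoothProjective.fiberOver_snd` — the fibres of the constant family of a smooth projective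
  `X` are smooth projective of the same dimension; `isSmoothProjectiveFamily_snd` — `pr₂` is a
  smooth projective family. (Surjectivity of `pr₂` for `X ≠ ∅` is the tree's instance
  `surjective_snd_left` of `Motives/CartierDivisorPullbackFromBase`, from `Surjective X.hom`.)

These are the "constant family" / "isotrivial family `X × ℙ¹ ⟶ ℙ¹`" witnesses used by several
Hodge-conjecture routes (anchors of `AnchorTransport`, supply of `BoundaryReadout`).

## References

* [Hartshorne1977] R. Hartshorne, Algebraic Geometry, GTM 52, II.3 (p. 89, fibre of a morphism)
  and III Prop. 10.1 (b) (base change of smooth morphisms).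
-/

universe u

open CategoryTheory CategoryTheory.Limits AlgebraicGeometry MonoidalCategory CartesianMonoidalCategory

noncomputable section

namespace Literature.AlgebraicGeometry.Motives

variable {k : Type u} [Field k] (X : SchemeOver k) {C : SchemeOver k} (t : AlgPoints C k)

/-! ### Morphisms to `Spec k` -/

/-- A `k`-scheme has exactly one `k`-morphism to `Spec k` (the structure map of `specOver k k` is an
isomorphism). [cite: Hartshorne1977, II.3 (p. 89)] -/
instance subsingleton_hom_specOver_self : Subsingleton (X ⟶ specOver k k) := by
  refine ⟨fun f g => Over.OverMorphism.ext ?_⟩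
  haveI := CurveNet.isIso_specOver_self_hom k
  rw [← cancel_mono (specOver k k).hom, Over.w f, Over.w g]

/-! ### The fibre of the constant family over a rational point -/

/-- **`X ×ₖ Spec k ≅ (X ×ₖ C)_t`**: both are the base change of `pr₂ : X ×ₖ C ⟶ C` along the rational
point `t : Spec k ⟶ C`, as an isomorphism of `k`-schemes. [cite: Hartshorne1977, II.3 (p. 89)] -/
def constFamilyFiberIso : X ⊗ specOver k k ≅ fiberOver (snd X C) t :=
  IsPullback.isoIsPullback _ _ (isPullback_snd_whiskerLeft t X).flip
    (familyPullback.isPullback (snd X C) t)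

/-- `X ×ₖ Spec k ≅ (X ×ₖ C)_t ⟶ X ×ₖ C` is `X ◁ t`. [cite: Hartshorne1977, II.3 (p. 89)] -/
@[reassoc (attr := simp)]
theorem constFamilyFiberIso_hom_fiberι :
    (constFamilyFiberIso X t).hom ≫ fiberι (snd X C) t = X ◁ t :=
  IsPullback.isoIsPullback_hom_fst _ _ _ _

/-- **The slice isomorphism `X ≅ (X ×ₖ C)_t`** onto the fibre of the constant family `pr₂ : X ×ₖ C ⟶ C`
over a rational point `t ∈ C(k)` (`X ≅ X ×ₖ Spec k ≅ (X ×ₖ C)_t`). [cite: Hartshorne1977, II.3 (p. 89)] -/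
def sliceFiberIso : X ≅ fiberOver (snd X C) t :=
  (ρ_ X).symm ≪≫ whiskerLeftIso X (AffineLineProduct.specOverSelfIso k).symm ≪≫ constFamilyFiberIso X t

/-- The slice isomorphism followed by the fibre inclusion and `pr₁` is the identity of `X`.
[cite: Hartshorne1977, II.3 (p. 89)] -/
@[reassoc (attr := simp)]
theorem sliceFiberIso_hom_fiberι_fst :
    (sliceFiberIso X t).hom ≫ fiberι (snd X C) t ≫ fst X C = 𝟙 X := by
  simp only [sliceFiberIso, Iso.trans_hom, Iso.symm_hom, whiskerLeftIso_hom, Category.assoc,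
    constFamilyFiberIso_hom_fiberι_assoc, whiskerLeft_fst]
  exact rightUnitor_inv_fst X

/-- The slice isomorphism followed by the fibre inclusion and `pr₂` is the constant map to `t`.
[cite: Hartshorne1977, II.3 (p. 89)] -/
@[reassoc (attr := simp)]
theorem sliceFiberIso_hom_fiberι_snd :
    (sliceFiberIso X t).hom ≫ fiberι (snd X C) t ≫ snd X C = toSpecOver X ≫ t := by
  simp only [sliceFiberIso, Iso.trans_hom, Iso.symm_hom, whiskerLeftIso_hom, Category.assoc,
    constFamilyFiberIso_hom_fiberι_assoc, whiskerLeft_snd, whiskerLeft_snd_assoc]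
  rw [← Category.assoc, ← Category.assoc]
  congr 1
  exact Subsingleton.elim _ _

/-- **The slice isomorphism followed by the fibre inclusion IS the slice** `sliceAt X t = (𝟙, t)`.
[cite: Hartshorne1977, II.3 (p. 89)] -/
@[reassoc]
theorem sliceFiberIso_hom_fiberι :
    (sliceFiberIso X t).hom ≫ fiberι (snd X C) t = sliceAt X t :=
  CartesianMonoidalCategory.hom_ext _ _
    (by rw [Category.assoc, sliceFiberIso_hom_fiberι_fst, sliceAt_fst])
    (by rw [Category.assoc, sliceFiberIso_hom_fiberι_snd, sliceAt_snd])

/-- Hence the slice `sliceAt X t : X ⟶ X ×ₖ C` factors through the fibre inclusion by an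
isomorphism; in particular its image is the whole fibre `(X ×ₖ C)_t`. [cite: Hartshorne1977, II.3 (p. 89)] -/
theorem range_fiberι_snd_eq_range_sliceAt :
    Set.range (fiberι (snd X C) t).left.base = Set.range (sliceAt X t).left.base := by
  rw [← sliceFiberIso_hom_fiberι, Over.comp_left, Scheme.Hom.comp_base, TopCat.coe_comp,
    Set.range_comp]
  have : Set.range ((sliceFiberIso X t).hom.left.base) = Set.univ := by
    refine Set.eq_univ_of_forall fun x => ⟨(sliceFiberIso X t).inv.left.base x, ?_⟩
    rw [← Scheme.Hom.comp_apply, ← Over.comp_left, Iso.inv_hom_id, Over.id_left]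
    rfl
  rw [this, Set.image_univ]

/-! ### Smoothness and properness -/

variable {X} in
/-- The fibres of the constant family of a smooth projective `X` over rational points are smooth
projective of the same dimension (they are isomorphic to `X`). [cite: Hartshorne1977, III Prop. 10.1 (b)] -/
theorem IsSmoothProjective.fiberOver_snd {n : ℕ} (hX : IsSmoothProjective n X) :
    IsSmoothProjective n (fiberOver (snd X C) t) :=
  hX.of_iso (sliceFiberIso X t)

variable {X} in
/-- **The constant family of a smooth projective variety is a smooth projective family**:
`pr₂ : X ×ₖ C ⟶ C` is smooth of relative dimension `n` and proper (base change of `X ⟶ Spec k`),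
with smooth projective fibres (`IsSmoothProjective.fiberOver_snd`). [cite: Hartshorne1977, III Prop. 10.1 (b)] -/
theorem isSmoothProjectiveFamily_snd {n : ℕ} (hX : IsSmoothProjective n X) (C : SchemeOver k) :
    IsSmoothProjectiveFamily (snd X C) n where
  smoothOfRelativeDimension := by
    haveI := smoothOfRelativeDimension_isStableUnderBaseChange (n := n)
    exact MorphismProperty.pullback_snd (P := @SmoothOfRelativeDimension n) X.hom C.hom
      hX.smoothOfRelativeDimension
  isProper := by
    haveI : IsProper X.hom := IsSmoothProjective.isProper_holds hX
    exact inferInstanceAs (IsProper (pullback.snd X.hom C.hom))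
  isSmoothProjective s := hX.fiberOver_snd s

end Literature.AlgebraicGeometry.Motives

end
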